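import Literature.NumberTheory.EllipticCurves.LeadingTerm
import Literature.NumberTheory.EllipticCurves.KatoRankBoundProofs
import Literature.NumberTheory.EllipticCurves.BSDInvariantsProofs
import Literature.NumberTheory.EllipticCurves.GlobalMinimalModelProofs
import Literature.NumberTheory.DiophantineGeometry.Conductor
import Literature.NumberTheory.EllipticCurves.BSDLowerBoundLayersProofs

/-!
# The rank conjecture `∀ E/ℚ, ord_{s=1} L(E,s) = rank E(ℚ)` in two-wall form, and its low-rank part as finiteness of `Ш`

Write `a = ord_{s=1} L(E,s)`, `r = rank E(ℚ)`, `ρ_p = ord_{T=0} L_p(E,T)` (`(padicLFunction f (unitRoot W p)).order`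
for the newform `f` of `E` and a good ordinary `p`).  Three bookkeeping theorems about the statement
`∀ E/ℚ, a = r` (the rank part of the Birch–Swinnerton-Dyer conjecture, written out), each over
named published facts passed as explicit hypotheses:

* `forall_analyticRank_eq_rank_iff_cells` / `forall_analyticRank_eq_rank_iff_upper_and_lower` —
  over Gross–Zagier–Kolyvagin (`a ≤ 1 ⟹ r = a`): `(∀ E, a = r)` is equivalent to the three cells
  `r = 0 ⟹ a = 0`, `r = 1 ⟹ a = 1`, `r ≥ 2 ∧ a ≥ 2 ⟹ a = r`, and to the conjunction of the
  UPPER BOUND in the deep regime `r ≥ 3 ∧ a ≥ 2 ⟹ r ≤ a` with the LOWER BOUND `a ≥ 2 ⟹ a ≤ r`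
  (the two walls; `r ≥ 2 ⟹ a ≥ 2` and `r = 2 ∧ a ≥ 2 ⟹ r ≤ a` are free).
* `forall_analyticRank_eq_rank_iff_finite_sha_and_deepCell` — over GZK, the rank-zero `p`-converse
  (modularity + Mazur's main conjecture à la Burungale–Castella–Skinner + Perrin-Riou–Schneider) and
  the rank-one `p`-converses (Kim; Burungale–Tian): `(∀ E, a = r)` is equivalent to
  `(∀ E, r ≤ 1 ⟹ Ш(E) finite) ∧ (∀ E, r ≥ 2 ⟹ a ≥ 2 ⟹ a = r)` — in algebraic rank `≤ 1` nothing
  analytic is open, only the finiteness of `Ш`.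
* `forall_analyticRank_eq_rank_of_orderTransfer_of_lowerBound` — over GZK, modularity and Kato's
  rank bound `r ≤ ρ_p` at odd good ordinary primes (Astérisque 295, Thm. 18.4): the upper wall is
  implied by the ONE-SIDED `p`-ADIC ORDER TRANSFER "for every globally minimal `E` with `r ≥ 3`,
  `a ≥ 2` there is an odd good ordinary `p` with `ρ_p ≤ a`" (the `≤` half of Mazur–Tate–Teitelbaum's
  `p`-adic BSD comparison in the non-exceptional case), by the squeeze `r ≤ ρ_p ≤ a`
  (`rank_le_analyticRank_of_order_padicLFunction_le`); so `(order transfer) ∧ (lower bound) ⟹ ∀ E, a = r`.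
  Conversely `a = r` gives only `a ≤ ρ_p` (`analyticRank_le_order_padicLFunction_of_analyticRank_eq_rank`):
  the transfer is genuinely extra, `p`-adic information.

References: B. Gross, D. Zagier, Invent. Math. 84 (1986); V. Kolyvagin (1990); H. Darmon, *Rational
points on modular elliptic curves* (2004), Thm. 3.22; K. Kato, Astérisque 295 (2004), Thm. 18.4;
B. Mazur, J. Tate, J. Teitelbaum, Invent. Math. 84 (1986), Ch. I §16 Conjecture (p. 23) and Ch. II §10
Conjecture (BSD(p)) I (i) (p. 38) (orders of vanishing: `ρ_p = ρ_∞` in the non-exceptional case; the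
paper's Ch. II ends at §15 — an earlier draft's locator "§II.18–19" was a slip); R. Greenberg, LNM 1716 (1999),
§1; C.-H. Kim, Math. Ann. 387 (2022), Cor. 1.4; A. Burungale, Y. Tian, Invent. Math. 220 (2020);
A. Burungale, F. Castella, C. Skinner, arXiv:2405.00270, Thm. 1.1.2 (a).
-/

open scoped Classical MatrixGroups ModularForm
open CongruenceSubgroup WeierstrassCurve Literature.NumberTheory.EllipticCurves.ModularForms

namespace Literature.NumberTheory.EllipticCurves

/-! ### The cell decomposition and the two walls (over Gross–Zagier–Kolyvagin) -/

/-- **Cells.** Over GZK (`a ≤ 1 ⟹ r = a`): `(∀ E, a = r) ↔ (r = 0 ⟹ a = 0) ∧ (r = 1 ⟹ a = 1) ∧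
(r ≥ 2 ∧ a ≥ 2 ⟹ a = r)` (for `r ≥ 2`, `a ≤ 1` is impossible since then `r = a ≤ 1`).
[cite: Darmon2004, Thm. 3.22] -/
theorem forall_analyticRank_eq_rank_iff_cells (hGZK : rank_eq_analyticRank_of_analyticRank_le_one) :
    (∀ W : WeierstrassCurve ℚ, W.IsElliptic → W.analyticRank = W.mordellWeilRank) ↔
      (∀ W : WeierstrassCurve ℚ, W.IsElliptic → W.mordellWeilRank = 0 → W.analyticRank = 0) ∧
      (∀ W : WeierstrassCurve ℚ, W.IsElliptic → W.mordellWeilRank = 1 → W.analyticRank = 1) ∧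
      (∀ W : WeierstrassCurve ℚ, W.IsElliptic → 2 ≤ W.mordellWeilRank → 2 ≤ W.analyticRank →
        W.analyticRank = W.mordellWeilRank) := by
  constructor
  · intro h
    exact ⟨fun W hE hr => by rw [h W hE, hr], fun W hE hr => by rw [h W hE, hr],
      fun W hE _ _ => h W hE⟩
  · rintro ⟨h0, h1, h2⟩ W hE
    by_cases ha : W.analyticRank ≤ 1
    · exact (hGZK W ha).1.symm
    · rcases Nat.lt_or_ge W.mordellWeilRank 2 with hr | hr
      · rcases Nat.lt_or_ge W.mordellWeilRank 1 with hr0 | hr1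
        · have := h0 W hE (by omega); omega
        · have := h1 W hE (by omega); omega
      · exact h2 W hE hr (by omega)

/-- **Two walls.** Over GZK: `(∀ E, a = r) ↔ (∀ E, r ≥ 3 → a ≥ 2 → r ≤ a) ∧ (∀ E, a ≥ 2 → a ≤ r)` —
the upper bound is open only for `r ≥ 3 ∧ a ≥ 2` and the lower bound only for `a ≥ 2`; the case
`r = 2 ∧ a ≥ 2` of the upper bound follows from the lower bound. [cite: Darmon2004, Thm. 3.22] -/
theorem forall_analyticRank_eq_rank_iff_upper_and_lower
    (hGZK : rank_eq_analyticRank_of_analyticRank_le_one) :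
    (∀ W : WeierstrassCurve ℚ, W.IsElliptic → W.analyticRank = W.mordellWeilRank) ↔
      (∀ W : WeierstrassCurve ℚ, W.IsElliptic → 3 ≤ W.mordellWeilRank → 2 ≤ W.analyticRank →
        W.mordellWeilRank ≤ W.analyticRank) ∧
      (∀ W : WeierstrassCurve ℚ, W.IsElliptic → 2 ≤ W.analyticRank →
        W.analyticRank ≤ W.mordellWeilRank) := by
  constructor
  · intro h
    exact ⟨fun W hE _ _ => (h W hE).symm.le, fun W hE _ => (h W hE).le⟩
  · rintro ⟨hup, hlow⟩ W hE
    exact analyticRank_eq_rank_of_lowerBound_of_upperBoundDeep hGZK hlow hup W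

/-! ### The low-rank part is the finiteness of `Ш` in rank `≤ 1` -/

/-- **`(∀ E, a = r) ↔ (Ш finite in rank ≤ 1) ∧ (deep cell)`.** Over GZK, the rank-zero `p`-converse
(modularity `hmod`, Mazur's main conjecture `hMC`, Perrin-Riou–Schneider `hS`) and the rank-one
`p`-converses (`hKim`, `hBT`): the rank statement for ALL elliptic curves over `ℚ` is equivalent to
(i) `Ш(E/ℚ)` finite for every `E` of rank `≤ 1` and (ii) `a = r` whenever `r ≥ 2` and `a ≥ 2`.
[cite: Kim2022, §1 diagram (1.1) and Cor. 1.4] [cite: GreenbergLNM1716, §1 pp. 65–66]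
[cite: Darmon2004, Thm. 3.22] -/
theorem forall_analyticRank_eq_rank_iff_finite_sha_and_deepCell
    (hGZK : rank_eq_analyticRank_of_analyticRank_le_one)
    (hKim : kim_analyticRank_eq_one_of_mordellWeilRank_eq_one)
    (hBT : burungaleTian_analyticRank_eq_one_of_selmerCorank_eq_one_of_hasCM)
    (hmod : exists_isNewformOf) (hMC : burungale_castella_skinner_charIdeal_eq_padicLFunction)
    (hS : Schneider1985_order_charGenerator) :
    (∀ W : WeierstrassCurve ℚ, W.IsElliptic → W.analyticRank = W.mordellWeilRank) ↔
      (∀ W : WeierstrassCurve ℚ, W.IsElliptic → W.mordellWeilRank ≤ 1 → Finite W.sha) ∧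
      (∀ W : WeierstrassCurve ℚ, W.IsElliptic → 2 ≤ W.mordellWeilRank → 2 ≤ W.analyticRank →
        W.analyticRank = W.mordellWeilRank) := by
  constructor
  · intro h
    refine ⟨fun W hE hr => ?_, fun W hE _ _ => h W hE⟩
    have ha : W.analyticRank ≤ 1 := by rw [h W hE]; exact hr
    exact (hGZK W ha).2
  · rintro ⟨hsha, hdeep⟩ W hE
    have h2 := (forall_two_le_rank_of_two_le_analyticRank_iff hGZK hKim hBT hmod hMC hS).2 hsha
    by_cases ha : W.analyticRank ≤ 1
    · exact (hGZK W ha).1.symm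
    · exact hdeep W hE (h2 W hE (by omega)) (by omega)

/-! ### The upper wall from the one-sided `p`-adic order transfer (Kato's squeeze) -/

/-- **The squeeze at one prime.** On a globally minimal model with newform `f`, at an odd good
ordinary `p`: Kato's `rank E(ℚ) ≤ ord_{T=0} L_p(E,T)` and `ord_{T=0} L_p(E,T) ≤ ord_{s=1} L(E,s)`
give `rank E(ℚ) ≤ ord_{s=1} L(E,s)`. [cite: Kato2004, Thm. 18.4] -/
theorem rank_le_analyticRank_of_order_padicLFunction_le
    (W : WeierstrassCurve ℚ) [W.IsElliptic] [W.IsGloballyMinimal] {N : ℕ} [NeZero N]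
    (f : CuspForm (Gamma0 N) 2) (hf : IsNewformOf W f) (p : ℕ) [Fact p.Prime] (hp2 : p ≠ 2)
    (hord : IsOrdinaryAt W p) (hKato : kato_mordellWeilRank_le_order_padicLFunction W p (f := f))
    (hle : (padicLFunction f (unitRoot W p : ℚ_[p])).order ≤ (W.analyticRank : ℕ∞)) :
    W.mordellWeilRank ≤ W.analyticRank := by
  have hk : (W.mordellWeilRank : ℕ∞) ≤ (padicLFunction f (unitRoot W p : ℚ_[p])).order :=
    hKato hp2 hord hf
  exact_mod_cast hk.trans hle

/-- **Converse direction is free**: if `a = r` then `a ≤ ρ_p` at every odd good ordinary prime, by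
Kato's bound alone — the rank statement pins `ρ_p` from below only. [cite: Kato2004, Thm. 18.4] -/
theorem analyticRank_le_order_padicLFunction_of_analyticRank_eq_rank
    (W : WeierstrassCurve ℚ) [W.IsElliptic] [W.IsGloballyMinimal] {N : ℕ} [NeZero N]
    (f : CuspForm (Gamma0 N) 2) (hf : IsNewformOf W f) (p : ℕ) [Fact p.Prime] (hp2 : p ≠ 2)
    (hord : IsOrdinaryAt W p) (hKato : kato_mordellWeilRank_le_order_padicLFunction W p (f := f))
    (h : W.analyticRank = W.mordellWeilRank) :
    (W.analyticRank : ℕ∞) ≤ (padicLFunction f (unitRoot W p : ℚ_[p])).order := by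
  rw [h]; exact hKato hp2 hord hf

/-- **The upper wall from the order transfer, for every equation.** Granting Kato's bound at odd good
ordinary primes (`hKato`) and modularity with level = conductor (`hmod`): if every globally minimal
`E/ℚ` with `rank ≥ 3`, `ord ≥ 2` has an odd good ordinary `p` with `ord_{T=0} L_p ≤ ord_{s=1} L`
(`hOT`), then `rank ≤ ord` for every `E/ℚ` with `rank ≥ 3`, `ord ≥ 2` (global minimal model by
Néron, invariance of both ranks). [cite: Kato2004, Thm. 18.4]
[cite: MazurTateTeitelbaum1986Invent, Ch. I §16 Conjecture (p. 23); Ch. II §10 Conjecture (BSD(p)) I (i) (p. 38)] -/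
theorem rank_le_analyticRank_of_three_le_of_orderTransfer
    (hKato : ∀ (W : WeierstrassCurve ℚ) [W.IsElliptic] [W.IsGloballyMinimal] (p : ℕ) [Fact p.Prime]
      {N : ℕ} [NeZero N] {f : CuspForm (Gamma0 N) 2},
      kato_mordellWeilRank_le_order_padicLFunction W p (f := f))
    (hmod : exists_isNewformOf)
    (hOT : ∀ (W : WeierstrassCurve ℚ) [W.IsElliptic] [W.IsGloballyMinimal] {N : ℕ} [NeZero N]
      (f : CuspForm (Gamma0 N) 2), IsNewformOf W f → 3 ≤ W.mordellWeilRank → 2 ≤ W.analyticRank →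
        ∃ (p : ℕ) (_ : Fact p.Prime), p ≠ 2 ∧ IsOrdinaryAt W p ∧
          (padicLFunction f (unitRoot W p : ℚ_[p])).order ≤ (W.analyticRank : ℕ∞))
    (W : WeierstrassCurve ℚ) [W.IsElliptic] (hr : 3 ≤ W.mordellWeilRank) (ha : 2 ≤ W.analyticRank) :
    W.mordellWeilRank ≤ W.analyticRank := by
  obtain ⟨C, hC⟩ := hasGlobalMinimalModel_rat_holds W
  have hrC : (C • W).mordellWeilRank = W.mordellWeilRank := mordellWeilRank_variableChange_holds W C
  have haC : (C • W).analyticRank = W.analyticRank := analyticRank_variableChange_holds W C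
  haveI : NeZero ((C • W).conductorNorm ℤ) := ⟨((C • W).conductorNorm_pos_holds).ne'⟩
  obtain ⟨f, hf⟩ := hmod (C • W)
  obtain ⟨p, hp, hp2, hord, hle⟩ := hOT (C • W) f hf (by rw [hrC]; exact hr) (by rw [haC]; exact ha)
  have h := rank_le_analyticRank_of_order_padicLFunction_le (C • W) f hf p hp2 hord (hKato (C • W) p) hle
  rwa [hrC, haC] at h

/-- **Order transfer ∧ lower bound ⟹ the rank statement for every `E/ℚ`.** Over GZK, Kato's bound
and modularity: the one-sided `p`-adic order transfer in the deep regime together with the lower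
bound `ord ≥ 2 ⟹ ord ≤ rank` gives `ord_{s=1} L(E,s) = rank E(ℚ)` for every elliptic curve over `ℚ`.
[cite: Kato2004, Thm. 18.4] [cite: Darmon2004, Thm. 3.22]
[cite: MazurTateTeitelbaum1986Invent, Ch. I §16 Conjecture (p. 23); Ch. II §10 Conjecture (BSD(p)) I (i) (p. 38)] -/
theorem forall_analyticRank_eq_rank_of_orderTransfer_of_lowerBound
    (hGZK : rank_eq_analyticRank_of_analyticRank_le_one)
    (hKato : ∀ (W : WeierstrassCurve ℚ) [W.IsElliptic] [W.IsGloballyMinimal] (p : ℕ) [Fact p.Prime]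
      {N : ℕ} [NeZero N] {f : CuspForm (Gamma0 N) 2},
      kato_mordellWeilRank_le_order_padicLFunction W p (f := f))
    (hmod : exists_isNewformOf)
    (hOT : ∀ (W : WeierstrassCurve ℚ) [W.IsElliptic] [W.IsGloballyMinimal] {N : ℕ} [NeZero N]
      (f : CuspForm (Gamma0 N) 2), IsNewformOf W f → 3 ≤ W.mordellWeilRank → 2 ≤ W.analyticRank →
        ∃ (p : ℕ) (_ : Fact p.Prime), p ≠ 2 ∧ IsOrdinaryAt W p ∧
          (padicLFunction f (unitRoot W p : ℚ_[p])).order ≤ (W.analyticRank : ℕ∞))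
    (hlow : ∀ W : WeierstrassCurve ℚ, W.IsElliptic → 2 ≤ W.analyticRank →
      W.analyticRank ≤ W.mordellWeilRank)
    (W : WeierstrassCurve ℚ) [hE : W.IsElliptic] : W.analyticRank = W.mordellWeilRank :=
  analyticRank_eq_rank_of_lowerBound_of_upperBoundDeep hGZK hlow
    (fun V hV hr ha => @rank_le_analyticRank_of_three_le_of_orderTransfer hKato hmod hOT V hV hr ha) W

end Literature.NumberTheory.EllipticCurves
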